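import Mathlib
import Summits.NavierStokesRegularity.NavierStokesRegularity.Theorems.EulerZoomLiouvillePowerGaugeEulerLiouvilleBirthDefsThree
import HarnessLib

/-!
# Crux `EulerZoomLiouville.PowerGaugeEulerLiouville` (stmt-NavierStokesRegularity-19832): the binder predicates of the
# LEAD skeleton, part 4 (the SPIRAL stratum of line `relative_equilibria`)

Continuation of `…BirthDefsThree` (same namespace `…Theorems.PowerGaugeEulerLiouville.Birth`; importing THIS module gives all
binder predicates).  The six predicates of the O(3)-TWISTED self-similar («Perelman spiral») stratum, VERBATIM from the line file
`Cruxes/PowerGaugeEulerLiouville/Lines/relative_equilibria.lean` (ns-idea-11 g9–g12, commit 250c6f9066fe, l.128–170 and l.279–280),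
and the binder `IsPastSpiralSubExtremal` of the LEAD skeleton v118 (`stub_nonSelfSimilarRest`), which packages the hypotheses of the
line's R3 `Sig.stub_spiralSubExtremal` into one predicate of the member.  Credits / senses: the LEAD's `CENSUS-19832-v118.md`.

WHAT THIS IS NOT: not NS, not E — DEFINITIONS ONLY; the crux 19832 stays OPEN.
-/

noncomputable section

open MeasureTheory Set Filter Topology Metric
open scoped ENNReal NNReal ContDiff RealInnerProductSpace

-- flat `Theorems/<Route><Decl>…` files of one crux share the namespace of the crux (tree convention)
set_option linter.dupNamespace false

namespace Summit.NavierStokesRegularity.NavierStokesRegularity.Theorems.PowerGaugeEulerLiouville.Birth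

/-- A skew-adjoint generator (an infinitesimal rotation; in `ℝ³`, `S y = α k⃗ × y`).  Line `relative_equilibria`, VERBATIM. -/
@[reducible] def IsSkew (S : E3 →L[ℝ] E3) : Prop :=
  ∀ x y : E3, ⟪S x, y⟫ = -⟪x, S y⟫

/-- The ROTATION CLOCK generated by `S`, read at logarithmic time: `twist S s = e^{sS}` (an isometry when `S` is skew).
Line `relative_equilibria`, VERBATIM. -/
@[reducible] def twist (S : E3 →L[ℝ] E3) (s : ℝ) : E3 →L[ℝ] E3 :=
  NormedSpace.exp (s • S)

/-- RELATIVE SIMILARITY EQUILIBRIUM = PERELMAN'S SPIRAL ANSATZ on a past sub-slab: for `τ < T₁` (`T₁ ≤ T`, so `T − τ > 0`),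
`u(τ, x) = (T−τ)^{γ−1} · e^{(log(T−τ)) S} V( e^{−(log(T−τ)) S} (T−τ)^{−γ} (x − x₀) )`, `γ = 1/(2+ρ)` the class rate.
`S = 0` is `IsPastSelfSimilar ρ T T₁ x₀ u V`.  Line `relative_equilibria`, VERBATIM. -/
@[reducible] def IsPastSpiral (ρ T T₁ : ℝ) (x₀ : E3) (S : E3 →L[ℝ] E3) (u : ℝ → E3 → E3) (V : E3 → E3) : Prop :=
  ∀ τ : ℝ, τ < T₁ → u τ = fun x =>
    (T - τ) ^ (1 / (2 + ρ) - 1) •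
      twist S (Real.log (T - τ)) (V (twist S (-Real.log (T - τ)) ((T - τ) ^ (-(1 / (2 + ρ))) • (x - x₀))))

/-- The member IS a spiral member about some centre `(T, x₀)`, with some skew generator and some profile, on some past sub-slab.
Line `relative_equilibria`, VERBATIM. -/
@[reducible] def IsPastSpiralMember (ρ : ℝ) (u : ℝ → E3 → E3) : Prop :=
  ∃ (T T₁ : ℝ) (x₀ : E3) (S : E3 →L[ℝ] E3) (V : E3 → E3),
    T₁ ≤ 0 ∧ T₁ ≤ T ∧ IsSkew S ∧ IsPastSpiral ρ T T₁ x₀ S u V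

/-- SUB-EXTREMAL profile (the binder shape of `IsPastSelfSimilarSubExtremal`, first disjunct): the normalised energy
`L^{2ρ−1}∫_{B_L}|V|²` dips below every `ε` beyond every radius.  Line `relative_equilibria`, VERBATIM. -/
@[reducible] def IsSubExtremalProfile (ρ : ℝ) (V : E3 → E3) : Prop :=
  ∀ ε : ℝ, 0 < ε → ∀ L₀ : ℝ, ∃ L : ℝ, L₀ ≤ L ∧
    L ^ (2 * ρ - 1) * ∫ y in Metric.ball (0 : E3) L, ‖V y‖ ^ 2 < ε

/-- A test function has RADIAL GRADIENT when `∇θ(z)` is parallel to `z` at every point (e.g. `θ = σ(L⁻¹·)` for the radial cut-off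
`σ` of `EnergySaturation.exists_radialCutoff`).  Against such tests the spiral torque/transport term `∫|V|²⟪Sz, ∇θ(z)⟫` vanishes
(`⟪Sz, z⟫ = 0`).  Line `relative_equilibria`, VERBATIM (the Theorems-side endgame `Spiral.ae_eq_zero_of_subExtremal_loc_radial`
spells it out as `∀ z, ∃ m, gradient θ z = m • z`; reducible unfolding bridges). -/
@[reducible] def HasRadialGradient (θ : E3 → ℝ) : Prop :=
  ∀ z : E3, ∃ m : ℝ, gradient θ z = m • z

/-- Binder of `stub_nonSelfSimilarRest` (LEAD skeleton v118): the member is a SUB-EXTREMAL SPIRAL (O(3)-twisted self-similar)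
member — a Perelman spiral about some `(T, x₀)` with a skew generator `S` on a past sub-slab `τ < T₁ ≤ min 0 T`, whose profile
energy is sub-extremal (`liminf_{L→∞} L^{2ρ−1}∫_{B_L}|V|² = 0`).  Exactly the hypotheses of the line's R3 `Sig.stub_spiralSubExtremal`
packaged as one predicate; `S = 0` lies inside `IsPastSelfSimilarSubExtremal ρ u`. -/
@[reducible] def IsPastSpiralSubExtremal (ρ : ℝ) (u : ℝ → E3 → E3) : Prop :=
  ∃ (T T₁ : ℝ) (x₀ : E3) (S : E3 →L[ℝ] E3) (V : E3 → E3),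
    T₁ ≤ 0 ∧ T₁ ≤ T ∧ IsSkew S ∧ IsPastSpiral ρ T T₁ x₀ S u V ∧ IsSubExtremalProfile ρ V

end Summit.NavierStokesRegularity.NavierStokesRegularity.Theorems.PowerGaugeEulerLiouville.Birth

end
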